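import Summits.HodgeConjecture.HodgeConjecture.Theorems.VHCAbelianSchemesRoadIsogenyPullbackFormsIso
import Literature.AlgebraicGeometry.Modules.PushforwardIsoUnit
import Literature.AlgebraicGeometry.Modules.LinearOverBase
import HarnessLib

/-!
# Road №4 (`VHCAbelianSchemesRoad`) — the twist datum α₀ UNFOLDED: frame coordinates pull back by `g♯`, and the `ι•`-NORMALISATION
# `g_*(ι_E) ≫ α_0(g)(E) = ι_{g_*E}` (input (b) ∕ `IotaPushforwardCompat` of the (At)-pair for `stub_atiyahPair`, crux stmt-HodgeConjecture-26512)

research route conditional on HC_CM; not a corollary; Q11.4-sentence-2 already refuted in dim ≥ 3.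

Seat core-w6 (width copy of core-D), third sequel of `…IsogenyTwistPushforwardIso.lean` (the data (L7b) `α₀ = isogenyTwistPushforwardIsoFamily hΩ`,
p650171) and `…IsogenyPullbackFormsIso.lean` ((P2′) `dg` iso ⇒ `isogenyFormsTwist_eq`, p652022). `--supports stmt-HodgeConjecture-26512 --as helper`;
closes NO stub; CONDITIONAL on the named fact «`Ω¹_A` free» (`hΩ`) only; nothing here says (AtPair), (TrPair), (c1), T′, `HC_AV`, `HC_CM` or
HC holds; HC_CM HELD, by name only; typed ≠ proved.

WHAT IS PROVED (the module-level API of α₀ that core-qb's generic `TwistJetPushforwardCompat` ∕ core-w3's `IotaPushforwardCompat α` consume).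
* §1 `ιFree_comp_freeFinIsoPi_hom_comp_π` (`ι_J ≫ (𝒪^N ≅ ∏ᶜ𝒪) ≫ π_K = δ_{JK}`), `pullbackObjFreeIso_hom_comp_freeFinIsoPi_π` (Mathlib's
  `pullbackObjFreeIso` is «coordinatewise `g^*𝒪 ≅ 𝒪`»).
* §2 the `K`-th global frame coordinate `coord_K := (hodgeSheafFrame hΩ A q).hom ≫ π_K : Ω^q_A ⟶ 𝒪_A` and **`comap_comp_map_formsTwist_frameCoord`**:
  `g^♯ ≫ g_*(θ_q(g) ≫ coord_K) = coord_K ≫ g♯` — the `dg`-twist makes the frame coordinates of a pulled-back form the pull-backs of the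
  frame coordinates (transpose of `dg ≫ θ ≫ coord_K = g^*coord_K ≫ (g^*𝒪 ≅ 𝒪)` after `isogenyFormsTwist_eq`).
* §3 `isogenyTwistHodgePushforwardIso_hom_comp_twistFreeIso_π` (the frame components of `α_q(g)(E)`:
  `g_*(𝓗om(E^∨, θ ≫ coord_K) ≫ (E ≅ E^∨∨)⁻¹)`), `unitModule_endo_eq_globalScalar` (endomorphisms of `𝒪` are global scalars),
  `sheafHomMap_globalScalar`, `toBidual_sheafHomMap_inv`, `pushforward_map_globalScalar_appTop` (`g_*((g♯a)·𝟙) = a·𝟙`),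
  `hodgeSheafZeroIso_inv_comp_comap'` (pull-back of `0`-forms is `g♯`, any morphism of `S`-schemes).
* §4 **`map_toTwistHodgeZero_comp_isogenyTwistHodgePushforwardIso` : `g_*(ι_E) ≫ (isogenyTwistHodgePushforwardIso hΩ A g hg 0 E hE).hom =
  ι_{g_*E}`** (`ι = toTwistHodgeZero`) — input (b) for THIS α, by proof: in the one-element frame of `Ω⁰` both sides are the global
  scalars `a_src·𝟙` ∕ `a_tgt·𝟙` on `g_*E` with `a_src = g♯a_tgt` by §2 at `q = 0`.

NOT HERE (census for the next seat, see the seat's REPORT): the `wedgeD`-compatibility (W) `α_{j+1}(d(g♯a) ∧ φ) = da ∧ α_j(φ)` — same method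
one degree up: §3's components + §2 + the frame reconstruction `ω = Σ_I coord_I(ω)·ω_I` + `θ⁻¹(ω_I) = g^♯ω_I` + wedge ∕ `g^♯`
multiplicativity (`wedgeSheafHom_comp_sheafHomMap_comap`), tested on the sections over `U` after `(frame iso) ≫ π_K`.

References: [cite: Hartshorne1977, II Ex. 5.1 (a), (b), (d), II §5 pp. 109–110, II Prop. 8.11] [cite: MumfordAV1970, §4 (iii) (p. 42)]
[cite: BuchweitzFlenner2003, §3 (Atiyah class of a complex; the map ι)] [cite: GortzWedhorn2020, §(7.3), (7.3.6)].
-/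

noncomputable section

-- `TopCat.Presheaf`/`Scheme.Modules` are not reducible (as in Mathlib's `AlgebraicGeometry/Modules/Sheaf.lean`).
set_option backward.isDefEq.respectTransparency false

open CategoryTheory CategoryTheory.Limits AlgebraicGeometry Opposite TopologicalSpace
open AlgebraicGeometry.Scheme.Modules

namespace Summit.HodgeConjecture.HodgeConjecture.Ring2.SemiregularRepresentatives

set_option linter.dupNamespace false -- the cell's namespace repeats the summit name, as in every `Ring2*` file

open Literature.AlgebraicGeometry Literature.AlgebraicGeometry.Modules Literature.AlgebraicGeometry.Motives
open Literature.AlgebraicGeometry.Motives.AbelianVariety Literature.AlgebraicGeometry.HodgeTheory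
open Literature.AlgebraicGeometry.KTheory Literature.AlgebraicGeometry.Morphisms

/-! ## §1 The frame `𝒪^{Fin N} ≅ ∏ᶜ 𝒪` on injections and projections, and its pull-back -/

section Frame

/-- **`ι_J ≫ (𝒪^{Fin N} ≅ ∏ᶜ 𝒪) ≫ π_K = δ_{JK}`**: the comparison `freeFinIsoPi` of the free module (a coproduct) with the categorical
product sends the `J`-th coproduct injection to the `J`-th "unit vector". [folklore] -/
theorem ιFree_comp_freeFinIsoPi_hom_comp_π (X : Scheme.{0}) (N : ℕ) (J K : Fin N) :
    SheafOfModules.ιFree (R := X.ringCatSheaf) J ≫ (freeFinIsoPi X N).hom ≫ Limits.Pi.π _ K =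
      if J = K then 𝟙 (unitModule X) else 0 := by
  haveI : HasFiniteBiproducts X.Modules := HasFiniteBiproducts.of_hasFiniteProducts
  haveI : HasFiniteBiproducts (SheafOfModules X.ringCatSheaf) := HasFiniteBiproducts.of_hasFiniteProducts
  change Sigma.ι (fun _ : Fin N => unitModule X) J ≫
    ((biproduct.isoCoproduct fun _ : Fin N => unitModule X).inv ≫ (biproduct.isoProduct _).hom) ≫ Limits.Pi.π _ K = _
  rw [biproduct.isoCoproduct_inv, biproduct.isoProduct_hom]
  simp only [Category.assoc]
  rw [Limits.Sigma.ι_desc_assoc, Limits.Pi.lift_π]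
  by_cases h : J = K
  · subst h; rw [if_pos rfl, biproduct.ι_π_self]
  · rw [if_neg h, biproduct.ι_π_ne _ h]

/-- **The pull-back of the frame is the frame**: under Mathlib's `pullbackObjFreeIso : f^*𝒪_Y^{Fin N} ≅ 𝒪_X^{Fin N}` and the unit
comparison `pullbackObjUnitToUnit : f^*𝒪_Y ⟶ 𝒪_X`, the `K`-th coordinate of `𝒪_X^{Fin N}` is the pull-back of the `K`-th coordinate of
`𝒪_Y^{Fin N}`. [cite: Hartshorne1977, II §5 p. 110 (f^*𝒪_Y = 𝒪_X)] -/
theorem pullbackObjFreeIso_hom_comp_freeFinIsoPi_π {X Y : Scheme.{0}} (f : X ⟶ Y) [(Opens.map f.base).Final] (N : ℕ)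
    (K : Fin N) :
    (SheafOfModules.pullbackObjFreeIso f.toRingCatSheafHom (Fin N)).hom ≫ (freeFinIsoPi X N).hom ≫ Limits.Pi.π _ K =
      (Scheme.Modules.pullback f).map ((freeFinIsoPi Y N).hom ≫ Limits.Pi.π _ K) ≫
        SheafOfModules.pullbackObjUnitToUnit f.toRingCatSheafHom := by
  refine Cofan.IsColimit.hom_ext (isColimitCofanMkObjOfIsColimit (Scheme.Modules.pullback f) _ _
    (SheafOfModules.isColimitFreeCofan (R := Y.ringCatSheaf) (Fin N))) _ _ fun J => ?_
  change (Scheme.Modules.pullback f).map (SheafOfModules.ιFree J) ≫ _ =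
    (Scheme.Modules.pullback f).map (SheafOfModules.ιFree J) ≫ _
  have h := SheafOfModules.pullback_map_ιFree_comp_pullbackObjFreeIso_hom f.toRingCatSheafHom (I := Fin N) J
  rw [← Category.assoc]
  erw [h]
  rw [Category.assoc, ιFree_comp_freeFinIsoPi_hom_comp_π X N J K]
  rw [← Functor.map_comp_assoc, ιFree_comp_freeFinIsoPi_hom_comp_π Y N J K]
  by_cases h : J = K
  · rw [if_pos h, if_pos h, CategoryTheory.Functor.map_id, Category.id_comp, Category.comp_id]
  · rw [if_neg h, if_neg h, Functor.map_zero, zero_comp, comp_zero]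

end Frame

/-! ## §2 `g^♯` followed by a `dg`-twisted frame coordinate is the pulled-back coordinate -/

section Coord

/-- The tree's `f♯ : 𝒪_Y ⟶ f_*𝒪_X` (`Modules.unitPushforwardHom`) is Mathlib's `unitToPushforwardObjUnit` (same sections). [folklore] -/
theorem unitPushforwardHom_eq {X Y : Scheme.{0}} (f : X ⟶ Y) :
    unitPushforwardHom f = SheafOfModules.unitToPushforwardObjUnit f.toRingCatSheafHom :=
  Scheme.Modules.hom_ext _ _ fun U => AddCommGrpCat.ext fun (_ : Γ(Y, U)) => rfl

/-- **`g^♯` then a `dg`-twisted coordinate = the coordinate then `g♯`**: for every `K`,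
`g^♯ ≫ g_*(θ_q(g) ≫ coord_K) = coord_K ≫ (𝒪_A ⟶ g_*𝒪_A)` as morphisms `Ω^q_A ⟶ g_*𝒪_A` — the `dg`-twist `θ_q(g)` is exactly what
makes the pulled-back frame coordinates of `g^♯ω` the pull-backs `g♯` of the frame coordinates of `ω`. (Transposes under `g^* ⊣ g_*`:
`dg ≫ θ ≫ coord_K = g^*(coord_K) ≫ (g^*𝒪 ≅ 𝒪)`, which is `pullbackObjFreeIso_hom_comp_freeFinIsoPi_π` after `isogenyFormsTwist_eq`.)
CONDITIONAL on `hΩ`. [cite: Hartshorne1977, II Prop. 8.11 and III Prop. 10.4] [cite: MumfordAV1970, §4 (iii) (p. 42)] -/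
theorem comap_comp_map_formsTwist_frameCoord (hΩ : Mumford1970_cotangentSheaf_abelianVariety_free) (A : AbelianVariety ℂ) (g : A ⟶ A) (q : ℕ)
    (hg : IsIsogeny g) (K : Fin (A.dim.choose q)) :
    hodgeSheaf.comap g.hom.hom.hom q ≫ (pushforward (Hom.toSchemeHom g)).map
        ((isogenyFormsTwist hΩ A g q).hom ≫ ((hodgeSheafFrame hΩ A q).hom ≫ Limits.Pi.π _ K)) =
      ((hodgeSheafFrame hΩ A q).hom ≫ Limits.Pi.π _ K) ≫ unitPushforwardHom (Hom.toSchemeHom g) := by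
  haveI := isIso_isogenyPullbackForms hΩ A g hg q
  haveI := final_opensMap (Hom.toSchemeHom g)
  rw [unitPushforwardHom_eq]
  apply ((Scheme.Modules.pullbackPushforwardAdjunction (Hom.toSchemeHom g)).homEquiv _ _).symm.injective
  rw [Adjunction.homEquiv_naturality_right_symm, Adjunction.homEquiv_naturality_left_symm]
  change isogenyPullbackForms A g q ≫ (isogenyFormsTwist hΩ A g q).hom ≫ ((hodgeSheafFrame hΩ A q).hom ≫ Limits.Pi.π _ K) =
    (Scheme.Modules.pullback (Hom.toSchemeHom g)).map (((hodgeSheafFrame hΩ A q).hom ≫ Limits.Pi.π _ K)) ≫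
      SheafOfModules.pullbackObjUnitToUnit (Hom.toSchemeHom g).toRingCatSheafHom
  rw [isogenyFormsTwist_eq hΩ A g hg q]
  simp only [Iso.trans_hom, Iso.symm_hom, asIso_inv, Functor.mapIso_hom, hodgeSheafFrame, IsIso.hom_inv_id_assoc,
    Category.assoc, Iso.inv_hom_id_assoc, Functor.map_comp]
  rw [pullbackObjFreeIso_hom_comp_freeFinIsoPi_π]
  simp only [Functor.map_comp, Category.assoc]

end Coord

/-! ## §3 The frame components of `α_q(g)`; endomorphisms of `𝒪` as global scalars -/

section Components

/-- **The frame components of `α_q(g)(E)`**: `α_q(g)(E) ≫ (frame iso of the target twist) ≫ π_K =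
g_*(𝓗om(E^∨, θ_q(g) ≫ coord_K) ≫ (E ≅ E^∨∨)⁻¹)` — unfolding `pushforwardTwistFreeIso'`, the product comparison and `twistFreeIso_hom_π`.
CONDITIONAL on `hΩ`. [cite: Hartshorne1977, II Ex. 5.1 (a), (b), (d)] -/
theorem isogenyTwistHodgePushforwardIso_hom_comp_twistFreeIso_π (hΩ : Mumford1970_cotangentSheaf_abelianVariety_free) (A : AbelianVariety ℂ) (g : A ⟶ A)
    (hg : IsIsogeny g) (q : ℕ) (E : A.X.left.Modules) (hE : IsFiniteLocallyFree E)
    (K : Fin (A.dim.choose q)) :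
    haveI := isIso_toBidual E hE
    (isogenyTwistHodgePushforwardIso hΩ A g hg q E hE).hom ≫
        (twistFreeIso (hodgeSheafFrame hΩ A q) ((pushforward (Hom.toSchemeHom g)).obj E)
          (isogenyPushforwardFiniteLocallyFree_holds ℂ A A g hg E hE)).hom ≫ Limits.Pi.π _ K =
      (pushforward (Hom.toSchemeHom g)).map
        (sheafHomMap (dual E) ((isogenyFormsTwist hΩ A g q).hom ≫ ((hodgeSheafFrame hΩ A q).hom ≫ Limits.Pi.π _ K)) ≫ inv (toBidual E (unitModule _))) := by
  haveI := isIso_toBidual E hE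
  change (pushforwardTwistFreeIso' (Hom.toSchemeHom g) (hodgeSheafFrame hΩ A q) (hodgeSheafFrame hΩ A q) E hE
      (isogenyPushforwardFiniteLocallyFree_holds ℂ A A g hg E hE) (isogenyFormsTwist hΩ A g q)).hom ≫ _ ≫ _ = _
  rw [pushforwardTwistFreeIso'_hom, pushforwardTwistFreeIso_hom]
  simp only [Category.assoc, Iso.inv_hom_id_assoc]
  rw [PreservesProduct.iso_hom]
  erw [piComparison_comp_π (pushforward (Hom.toSchemeHom g)) (fun _ : Fin (A.dim.choose q) => E) K]
  rw [← Functor.map_comp, ← Functor.map_comp, twistFreeIso_hom_π]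
  congr 1

/-- **Endomorphisms of `𝒪_X` are global scalars**: `m = (m(1)) · 𝟙` for every `𝒪_X`-linear `m : 𝒪_X ⟶ 𝒪_X`.
[cite: Hartshorne1977, II §5 p. 109 (Hom_𝒪(𝒪, F) = Γ(X, F))] -/
theorem unitModule_endo_eq_globalScalar {X : Scheme.{0}} (m : unitModule X ⟶ unitModule X) :
    m = globalScalar (unitModule X) (m.app ⊤ (1 : Γ(X, ⊤))) := by
  refine Scheme.Modules.hom_ext _ _ fun U => AddCommGrpCat.ext fun (a : Γ(X, U)) => ?_
  rw [globalScalar_app_apply]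
  have h1 : m.app U a = a • m.app U (1 : Γ(X, U)) := by
    rw [← Scheme.Modules.Hom.app_smul, smul_eq_mul, mul_one]
  have h2 : m.app U (1 : Γ(X, U)) = X.presheaf.map (homOfLE (le_top : U ≤ ⊤)).op (m.app ⊤ (1 : Γ(X, ⊤))) := by
    have h := Scheme.Modules.Hom.app_map_apply m (homOfLE (le_top : U ≤ ⊤)) (1 : Γ(X, ⊤))
    have h1' : (unitModule X).presheaf.map (homOfLE (le_top : U ≤ ⊤)).op (1 : Γ(X, ⊤)) = (1 : Γ(X, U)) :=
      map_one (X.presheaf.map (homOfLE (le_top : U ≤ ⊤)).op).hom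
    rw [h1'] at h
    exact h
  change m.app U a = _
  rw [h1, h2, smul_eq_mul, smul_eq_mul, mul_comm]

/-- `𝓗om(E, –)` applied to a global scalar is the global scalar: `𝓗om(E, a·𝟙_M) = a·𝟙_{𝓗om(E,M)}`. [cite: Hartshorne1977, II §5 p. 109 (sheaf Hom)] -/
theorem sheafHomMap_globalScalar {X : Scheme.{0}} (E M : X.Modules) (a : Γ(X, ⊤)) :
    sheafHomMap E (globalScalar M a) = globalScalar (sheafHom E M) a := by
  refine Scheme.Modules.hom_ext _ _ fun U => AddCommGrpCat.ext fun (ψ : E.over U ⟶ M.over U) => ?_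
  rw [sheafHomMap_app_apply, globalScalar_app_apply]
  refine hom_ext_of_appLE fun W k s => ?_
  rw [appLE_comp_over_map, globalScalar_app_apply, appLE_smul]
  congr 1
  change _ = (X.presheaf.map (homOfLE (le_top : U ≤ ⊤)).op ≫ X.presheaf.map k.op) a
  rw [← Functor.map_comp]
  rfl

/-- `E ≅ E^∨∨` conjugates `𝓗om(E^∨, m)` to the global scalar `m(1)`: `(E → E^∨∨) ≫ 𝓗om(E^∨, m) ≫ (E^∨∨ → E) = m(1) · 𝟙_E` for an
endomorphism `m` of `𝒪_X`. [cite: Hartshorne1977, II Ex. 5.1 (a)] -/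
theorem toBidual_sheafHomMap_inv {X : Scheme.{0}} (E : X.Modules) [IsIso (toBidual E (unitModule X))]
    (m : unitModule X ⟶ unitModule X) :
    toBidual E (unitModule X) ≫ sheafHomMap (dual E) m ≫ inv (toBidual E (unitModule X)) =
      globalScalar E (m.app ⊤ (1 : Γ(X, ⊤))) := by
  nth_rw 1 [unitModule_endo_eq_globalScalar m]
  rw [sheafHomMap_globalScalar]
  have hc := globalScalar_comp (toBidual E (unitModule X)) (m.app ⊤ (1 : Γ(X, ⊤)))
  rw [← reassoc_of% hc, IsIso.hom_inv_id, Category.comp_id]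

/-- **`g_*` turns the pulled-back scalar into the scalar**: `g_*((g♯a) · 𝟙_M) = a · 𝟙_{g_*M}` (the `𝒪_Y`-module structure of `g_*M` is
through `g♯`). [cite: GortzWedhorn2020, §(7.3), (7.3.6)] -/
theorem pushforward_map_globalScalar_appTop {X Y : Scheme.{0}} (f : X ⟶ Y) (M : X.Modules) (a : Γ(Y, ⊤)) :
    (pushforward f).map (globalScalar M (f.appTop a)) = globalScalar ((pushforward f).obj M) a := by
  refine Scheme.Modules.hom_ext _ _ fun U => AddCommGrpCat.ext fun (x : Γ(M, f ⁻¹ᵁ U)) => ?_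
  change (X.presheaf.map (homOfLE (le_top : f ⁻¹ᵁ U ≤ ⊤)).op (f.appTop a)) • x =
    (f.app U (Y.presheaf.map (homOfLE (le_top : U ≤ ⊤)).op a)) • x
  congr 1
  exact (ConcreteCategory.congr_hom (f.naturality (homOfLE (le_top : U ≤ ⊤)).op) a).symm

/-- **Pull-back of `0`-forms is `g♯` on functions** (any morphism of `S`-schemes; the tree's `hodgeSheafZeroIso_inv_comp_comap` is the
isomorphism case): `(𝒪 ≅ Ω⁰)⁻¹ ≫ g^♯ = g♯ ≫ g_*((𝒪 ≅ Ω⁰)⁻¹)`. [cite: Hartshorne1977, II Prop. 8.11] -/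
theorem hodgeSheafZeroIso_inv_comp_comap' {S : Type} [CommRing S] {X₀ X₁ : Over (Spec (CommRingCat.of S))} (g' : X₀ ⟶ X₁) :
    (hodgeSheafZeroIso X₁).inv ≫ hodgeSheaf.comap g' 0 =
      unitPushforwardHom g'.left ≫ (pushforward g'.left).map (hodgeSheafZeroIso X₀).inv := by
  refine Scheme.Modules.hom_ext _ _ fun U => AddCommGrpCat.ext fun (a : Γ(X₁.left, U)) => ?_
  change (hodgeSheaf.comap g' 0).app U ((hodgeSheafZeroIso X₁).inv.app U a) =
    (hodgeSheafZeroIso X₀).inv.app (g'.left ⁻¹ᵁ U) (g'.left.app U a)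
  rw [hodgeSheafZeroIso_inv_app, hodgeSheafZeroIso_inv_app]
  erw [exteriorPower_iso₀_inv_apply, exteriorPower_iso₀_inv_apply, hodgeSheaf.comap_app_toHodgeSheaf,
    comapWedge_smul, comapWedge_mk]
  congr 2

/-! ## §4 (b) — the `ι•`-NORMALISATION of `α₀`: `g_*(ι_E) ≫ α_0(g)(E) = ι_{g_*E}` -/

/-- **(b) `IotaPushforwardCompat` for `α₀`, module level**: for an isogeny `g` and a finite locally free `E`,
`g_*(ι_E) ≫ α_0(g)(E) = ι_{g_*E}`, where `ι = toTwistHodgeZero : E ⟶ E ⊗ Ω⁰ = 𝓗om(E^∨, Ω⁰)`. Proof: in the frame of `Ω⁰` (one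
coordinate) both sides are global scalars on `g_*E` (`toBidual_sheafHomMap_inv`), `a_src · 𝟙` resp. `a_tgt · 𝟙`, and `a_src = g♯ a_tgt`
by the coordinate identity `comap_comp_map_formsTwist_frameCoord` composed with «pull-back of 0-forms is `g♯`»; `g_*((g♯a)·𝟙) = a·𝟙`.
CONDITIONAL on `hΩ`. [cite: Hartshorne1977, II Ex. 5.1 (a), (d)] [cite: BuchweitzFlenner2003, §3] -/
theorem map_toTwistHodgeZero_comp_isogenyTwistHodgePushforwardIso (hΩ : Mumford1970_cotangentSheaf_abelianVariety_free) (A : AbelianVariety ℂ) (g : A ⟶ A)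
    (hg : IsIsogeny g) (E : A.X.left.Modules) (hE : IsFiniteLocallyFree E) :
    (pushforward (Hom.toSchemeHom g)).map (toTwistHodgeZero E) ≫ (isogenyTwistHodgePushforwardIso hΩ A g hg 0 E hE).hom =
      toTwistHodgeZero ((pushforward (Hom.toSchemeHom g)).obj E) := by
  haveI := isIso_toBidual E hE
  have hgE := isogenyPushforwardFiniteLocallyFree_holds ℂ A A g hg E hE
  haveI := isIso_toBidual ((pushforward (Hom.toSchemeHom g)).obj E) hgE
  -- compare after the frame isomorphism of the target twist, componentwise
  rw [← cancel_mono (twistFreeIso (hodgeSheafFrame hΩ A 0) ((pushforward (Hom.toSchemeHom g)).obj E) hgE).hom]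
  refine Limits.Pi.hom_ext _ _ fun K => ?_
  simp only [Category.assoc]
  rw [isogenyTwistHodgePushforwardIso_hom_comp_twistFreeIso_π, twistFreeIso_hom_π, ← Functor.map_comp]
  -- both sides: `toBidual ≫ 𝓗om(E^∨, endomorphism of 𝒪) ≫ toBidual⁻¹` = a global scalar
  rw [toTwistHodgeZero, toTwistHodgeZero, Category.assoc, Category.assoc]
  have eL : toBidual E (unitModule _) ≫ sheafHomMap (dual E) (hodgeSheafZeroIso A.X).inv ≫
      sheafHomMap (dual E) ((isogenyFormsTwist hΩ A g 0).hom ≫ ((hodgeSheafFrame hΩ A 0).hom ≫ Limits.Pi.π _ K)) ≫ inv (toBidual E (unitModule _)) =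
      globalScalar E (((hodgeSheafZeroIso A.X).inv ≫ (isogenyFormsTwist hΩ A g 0).hom ≫ ((hodgeSheafFrame hΩ A 0).hom ≫ Limits.Pi.π _ K)).app ⊤
        (1 : Γ(A.X.left, ⊤))) := by
    rw [← Category.assoc (sheafHomMap _ _), ← sheafHomMap_comp]
    exact toBidual_sheafHomMap_inv E _
  have eR : toBidual ((pushforward (Hom.toSchemeHom g)).obj E) (unitModule _) ≫
      sheafHomMap (dual ((pushforward (Hom.toSchemeHom g)).obj E)) (hodgeSheafZeroIso A.X).inv ≫
        sheafHomMap (dual ((pushforward (Hom.toSchemeHom g)).obj E)) (((hodgeSheafFrame hΩ A 0).hom ≫ Limits.Pi.π _ K)) ≫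
          inv (toBidual ((pushforward (Hom.toSchemeHom g)).obj E) (unitModule _)) =
      globalScalar ((pushforward (Hom.toSchemeHom g)).obj E) (((hodgeSheafZeroIso A.X).inv ≫ ((hodgeSheafFrame hΩ A 0).hom ≫ Limits.Pi.π _ K)).app ⊤
        (1 : Γ(A.X.left, ⊤))) := by
    rw [← Category.assoc (sheafHomMap _ _), ← sheafHomMap_comp]
    exact toBidual_sheafHomMap_inv _ _
  rw [eL, eR, ← pushforward_map_globalScalar_appTop]
  congr 2
  -- the two scalars: `a_src = g♯ a_tgt`, from `g^♯ ≫ g_*(θ ≫ coord) = coord ≫ g♯` precomposed with `(𝒪 ≅ Ω⁰)⁻¹ ≫ g^♯ = g♯ ≫ g_*((𝒪 ≅ Ω⁰)⁻¹)`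
  have H : unitPushforwardHom (Hom.toSchemeHom g) ≫ (pushforward (Hom.toSchemeHom g)).map
      ((hodgeSheafZeroIso A.X).inv ≫ (isogenyFormsTwist hΩ A g 0).hom ≫ ((hodgeSheafFrame hΩ A 0).hom ≫ Limits.Pi.π _ K)) =
      ((hodgeSheafZeroIso A.X).inv ≫ ((hodgeSheafFrame hΩ A 0).hom ≫ Limits.Pi.π _ K)) ≫ unitPushforwardHom (Hom.toSchemeHom g) := by
    have h := comap_comp_map_formsTwist_frameCoord hΩ A g 0 hg K
    rw [Functor.map_comp, ← Category.assoc, ← hodgeSheafZeroIso_inv_comp_comap' g.hom.hom.hom, Category.assoc, h]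
    simp only [Category.assoc]
  have H1 := congrArg (fun φ : unitModule A.X.left ⟶ (pushforward (Hom.toSchemeHom g)).obj (unitModule A.X.left) =>
    Scheme.Modules.Hom.app φ ⊤ (1 : Γ(A.X.left, ⊤))) H
  have H2 : ((pushforward (Hom.toSchemeHom g)).map ((hodgeSheafZeroIso A.X).inv ≫ (isogenyFormsTwist hΩ A g 0).hom ≫
      ((hodgeSheafFrame hΩ A 0).hom ≫ Limits.Pi.π _ K))).app ⊤ ((unitPushforwardHom (Hom.toSchemeHom g)).app ⊤ (1 : Γ(A.X.left, ⊤))) =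
      ((hodgeSheafZeroIso A.X).inv ≫ (isogenyFormsTwist hΩ A g 0).hom ≫ ((hodgeSheafFrame hΩ A 0).hom ≫ Limits.Pi.π _ K)).app ⊤ (1 : Γ(A.X.left, ⊤)) := by
    rw [unitPushforwardHom_app_apply, map_one]
    rfl
  simp only [Scheme.Modules.Hom.comp_app, CategoryTheory.comp_apply] at H1
  rw [H2, unitPushforwardHom_app_apply] at H1
  simp only [Scheme.Modules.Hom.comp_app, CategoryTheory.comp_apply] at H1 ⊢
  refine H1.trans ?_
  rfl

end Components

end Summit.HodgeConjecture.HodgeConjecture.Ring2.SemiregularRepresentatives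

end
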